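import Summits.QuantumFields.YangMills.Theorems.CovariantDischargeSandwichLarge
import HarnessLib

/-!
# Crux `SandwichFractionalWindowTailL` (stmt-QuantumFields-24186, route-QuantumFields-CovariantDischarge r2) — REGISTERED STUB `stub_sandwichLarge` BY NAME
# (skeleton v5 `Cruxes/HistoryTailL/Lines/sandwich_discharge.lean` sha16 `470b3af6f9aa04e1` is registered on BOTH stmt-QuantumFields-19936 and
# stmt-QuantumFields-24186; the inhabitant ✓p708497 `CovariantDischargeSandwichLarge.stub_sandwichLarge` was filed `--supports stmt-QuantumFields-19936` only, so the
# 24186 registry row stayed unstamped — this 3-line alias gives that row its by-name inhabitant; registry == tree)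

Cell `ym3-torus` (YM ladder rung R3 = continuum SU(2) Yang–Mills on every three-torus — a RECORD rung, NOT the Clay problem), width seat
`ym-ust-19936-w5` gen 15 (the content theorem is this seat's lineage, gen 13).

WHAT THIS IS NOT.  Pure aliasing (`:= CovariantDischargeSandwichLarge.stub_sandwichLarge`); the content (large-threshold regime `1 < θ(Λb)(K−j)`, own `N₁ = 39`, footprint locality + finest-height tail) is in `CovariantDischargeSandwichLarge`.  The load-bearing capped sweep `stub_sandwichSweepGapCapped` and the
route's residual `SandwichDeepWindowTailL` are NOT proved here; nothing of `SandwichFractionalWindowTailL`, `HistoryTailL` or the rung is proved.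
YM₃ on T³ is rung R3 — NOT d = 4, NOT infinite volume, NOT a mass gap, NOT the Clay problem.

References: T. Bałaban, CMP **102** (1985) 255–275 [Balaban1985UV3] ((3) p.256, (7) p.257, (71) p.273); T. Bałaban, CMP **98** (1985) 17–51
[Balaban1985Averaging] (Prop. 1 (51) p.26).
-/

noncomputable section

open MeasureTheory
open Literature.MathematicalPhysics.QuantumFieldTheory.Balaban1983to89
open Literature.MathematicalPhysics.QuantumFieldTheory.Balaban1983to89.T3ContinuumYM3Torus

namespace Summit.QuantumFields.YangMills.Theorems.CovariantDischargeSandwichLarge24186Stub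

/-- **REGISTERED STUB `stub_sandwichLarge` of stmt-QuantumFields-24186 (skeleton v5 470b3af6f9aa), BY NAME**: the LARGE regime `1 < θ(Λb)(K−j)` of
the sandwich event on the coupled range `N₁·j + n ≤ K` — `:= CovariantDischargeSandwichLarge.stub_sandwichLarge` (✓p708497).
[cite: Balaban1985UV3, (3) p.256 and (7) p.257; Balaban1985Averaging, Prop. 1 (51) p.26] -/
theorem stub_sandwichLarge : (∀ (L : ℕ), ∃ N₁ : ℕ, 0 < N₁ ∧ ∀ (b₀ p₀ Λ : ℝ), 0 < b₀ → 2 < p₀ → 1 < Λ → ∃ (γ₁ C c : ℝ) (N : ℕ), 0 < γ₁ ∧ γ₁ ≤ 1 ∧ 0 < c ∧ ∀ (F : T3Family) (γ : ℝ), F.L = L → 0 < γ → γ ≤ γ₁ → ∀ (b : ℝ), b₀ ≤ b → ∀ (K n j : ℕ), 1 ≤ j → N₁ * j + n ≤ K → 1 < T3UnitScaleTilt.θBal F.L γ (Λ * b) p₀ (K - j) → ∀ p : Plaq (F.P K) j, (T3UnitScaleTilt.gibbsK F T3UnitLawDensityEML.ℰp γ K).real {U | (∀ k, k < j → PlaqSmall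 (T3UnitScaleTilt.θBal F.L γ b p₀ (K - k)) (Averaging.iter (fun i => BlockAveraging.blockAvg (P := F.P K) (j := i) T3UnitLawDensityEML.ℰp) k U)) ∧ (∀ j', j ≤ j' → j' + n ≤ K → PlaqSmall (T3UnitScaleTilt.θBal F.L γ (Λ * b) p₀ (K - j')) (Averaging.iter (fun i => BlockAveraging.blockAvg (P := F.P K) (j := i) T3UnitLawDensityEML.ℰp) j' U)) ∧ T3UnitScaleTilt.θBal F.L γ b p₀ (K - j) ≤ GaugeGroup.dist1 (GaugeField.plaqHol (Averaging.iter (fun i => BlockAveraging.blockAvg (P := F.P K) (j := i) T3UnitLawDensityEML.ℰp) j U) p)} ≤ C * ((γ * ((F.L : ℝ)⁻¹) ^ (K - j))⁻¹) ^ N * Real.exp (-(c * B10.pFun b₀ p₀ (Real.sqrt (γ * ((F.L : ℝ)⁻¹) ^ (K - j))) ^ 2))) :=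
  Summit.QuantumFields.YangMills.Theorems.CovariantDischargeSandwichLarge.stub_sandwichLarge

end Summit.QuantumFields.YangMills.Theorems.CovariantDischargeSandwichLarge24186Stub

end
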